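import Literature.MathematicalPhysics.QuantumFieldTheory.OSTemperedLevelZero
import HarnessLib

/-!
# The temperedness estimate (4.6) of OS II, Thm. 4.2: the induction (6.28) and the level choice (6.30)–(6.31)

Topic `Literature/MathematicalPhysics/QuantumFieldTheory`; support file (all proved; the explicit
constants as definitions; no named facts) for the discharge of (A1) `OS1975_exists_timeContinuation`.
Osterwalder–Schrader II (Comm. Math. Phys. 42 (1975)), Ch. VI.2: the bound (6.28)
`‖S_{k,ε}(ζ)‖ ≤ α_k β_k^{…N}` on `C_k^{(N)}` by induction on `N` ((6.29): the Schwarz step loses only a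
factor geometric in `k`, because the square root halves the sum `(2n−1) + (2m−1) = 2k` of the orders),
and its conversion into (4.6) = (6.31) by choosing the level `N = N(ζ)` with `2^N ≲ (∑|ζᵢ|/Re ζᵢ)²`
((6.30), `OSEnvelopeBases.osBaseC_exists_level_arg`) and the shift `ε` in terms of `Re ζ`:

* `gConst`, `levConst n k = lev0Const k · g^{kn}` — the constants of (6.28), and `closure_levConst` —
  `CT √(levConst n (2p+1) · levConst n (2q+1)) ≤ levConst (n+1) k` under the hypothesis
  `√(α_{2p+1} α_{2q+1}) ≤ γ^k α_k` on the real-point constants (true for OS's `α_k = a (k!)^b`);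
* `IsOSLabelledRealData.norm_regFun_le_level` — **(6.28) at every level** for the tower of
  `OSLabelledTower` started at `exists_levelZero`;
* `IsOSLabelledRealData.exists_tempered_tower` — **OS II Thm. 4.2 with (4.6), from real-point data**:
  a family `Sext k c`, holomorphic on `ℂ₊ᵏ` for the good labels, equal to `S₀` at the positive real
  points, with `‖Sext k c ζ‖ ≤ C_k (1 + ∑|ζᵢ|)^{e_k} (1 + ∑(Re ζᵢ)⁻¹)^{e_k}` on `ℂ₊ᵏ`, **uniformly over the
  good labels**.

## References

* K. Osterwalder, R. Schrader, *Axioms for Euclidean Green's functions II*, Comm. Math. Phys.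
  42 (1975) 281–305, §IV.2 Thm. 4.2 (4.6); Ch. V.2 Lemma 5.2, Cor. 5.3; Ch. VI.2 (6.28)–(6.31). [OsterwalderSchraderCMP1975]
-/

noncomputable section

open Metric Set Filter Complex
open scoped Topology ComplexConjugate InnerProductSpace BigOperators

namespace Literature.MathematicalPhysics.QuantumFieldTheory.OSEnvelope

open Literature.Analysis.Complex Literature.MathematicalPhysics.QuantumFieldTheory
  Literature.MathematicalPhysics.QuantumFieldTheory.LogSlot

variable {E : Type*} {H : Type*} [NormedAddCommGroup H] [InnerProductSpace ℂ H]

/-! ### The constants of (6.28) and the closure of the Schwarz step -/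

/-- **The growth factor per level and per order** `g = 4ᵗ · 2 (max 1 CT)² γ²`. [cite: OsterwalderSchraderCMP1975, Ch. VI.2 (6.29)] -/
def gConst (CT γ : ℝ) (t : ℕ) : ℝ := (4 : ℝ) ^ t * (2 * max 1 CT ^ 2 * γ ^ 2)

/-- **The constants of (6.28)**: `levConst n k = lev0Const k · g^{kn}`. [cite: OsterwalderSchraderCMP1975, Ch. VI.2 (6.28)] -/
def levConst (CT : ℝ) (α : ℕ → ℝ) (γ : ℝ) (t : ℕ) (ε : ℝ) (n k : ℕ) : ℝ :=
  lev0Const CT α t k ε * gConst CT γ t ^ (k * n)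

/-- `1 ≤ g`. [folklore] -/
theorem one_le_gConst (CT : ℝ) {γ : ℝ} (hγ : 1 ≤ γ) (t : ℕ) : 1 ≤ gConst CT γ t := by
  unfold gConst
  have h1 : (1 : ℝ) ≤ 4 ^ t := one_le_pow₀ (by norm_num)
  have h2 : (1 : ℝ) ≤ max 1 CT ^ 2 := one_le_pow₀ (le_max_left _ _)
  have h3 : (1 : ℝ) ≤ γ ^ 2 := one_le_pow₀ hγ
  have h4 : (1 : ℝ) ≤ 2 * max 1 CT ^ 2 := by linarith
  exact one_le_mul_of_one_le_of_one_le h1 (one_le_mul_of_one_le_of_one_le h4 h3)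

/-- `0 ≤ levConst`. [folklore] -/
theorem levConst_nonneg {CT : ℝ} {α : ℕ → ℝ} (hα : ∀ k, 0 ≤ α k) {γ : ℝ} (hγ : 1 ≤ γ) (t : ℕ) {ε : ℝ} (hε : 0 < ε)
    (n k : ℕ) : 0 ≤ levConst CT α γ t ε n k :=
  mul_nonneg (lev0Const_nonneg hα t k hε) (pow_nonneg (zero_le_one.trans (one_le_gConst CT hγ t)) _)

/-- `levConst` is monotone in the level. [folklore] -/
theorem levConst_le_succ {CT : ℝ} {α : ℕ → ℝ} (hα : ∀ k, 0 ≤ α k) {γ : ℝ} (hγ : 1 ≤ γ) (t : ℕ) {ε : ℝ} (hε : 0 < ε)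
    (n k : ℕ) : levConst CT α γ t ε n k ≤ levConst CT α γ t ε (n + 1) k := by
  unfold levConst
  refine mul_le_mul_of_nonneg_left (pow_le_pow_right₀ (one_le_gConst CT hγ t) ?_) (lev0Const_nonneg hα t k hε)
  exact Nat.mul_le_mul_left k (Nat.le_succ n)

/-- **`Â_j ≤ (max 1 CT) · j · γʲ · α j`** for `j ≥ 1`, under the hypothesis on the real-point constants. [folklore] -/
theorem lev0A_le {CT : ℝ} {α : ℕ → ℝ} (hα : ∀ k, 0 ≤ α k) {γ : ℝ} (hγ : 1 ≤ γ)
    (hα2 : ∀ (k : ℕ) (p : Fin k), Real.sqrt (α (p + 1 + p) * α (k - 1 - p + 1 + (k - 1 - p))) ≤ γ ^ k * α k)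
    {j : ℕ} (hj : 0 < j) : lev0A CT α j ≤ max 1 CT * j * γ ^ j * α j := by
  have hM1 : 1 ≤ max 1 CT := le_max_left _ _
  have hj1 : (1 : ℝ) ≤ j := by exact_mod_cast hj
  have hγj : 1 ≤ γ ^ j := one_le_pow₀ hγ
  unfold lev0A
  refine max_le ?_ ?_
  · -- `α j ≤ M₁ j γ^j α j`
    have : 1 ≤ max 1 CT * j * γ ^ j :=
      one_le_mul_of_one_le_of_one_le (one_le_mul_of_one_le_of_one_le hM1 hj1) hγj
    exact le_mul_of_one_le_left (hα j) this
  · calc max CT 0 * ∑ p : Fin j, Real.sqrt (α (p + 1 + p) * α (j - 1 - p + 1 + (j - 1 - p)))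
        ≤ max 1 CT * ∑ _p : Fin j, γ ^ j * α j :=
          mul_le_mul (max_le (le_max_right _ _) (zero_le_one.trans hM1)) (Finset.sum_le_sum fun p _ => hα2 j p)
            (Finset.sum_nonneg fun p _ => Real.sqrt_nonneg _) (zero_le_one.trans hM1)
      _ = max 1 CT * j * γ ^ j * α j := by
          rw [Finset.sum_const, Finset.card_univ, Fintype.card_fin, nsmul_eq_mul]; ring

/-- The factor `(1 + 4j/ε)^{tj}` for `j ≤ 2k`: `≤ (2 (1 + 4k/ε))^{tj}`. [folklore] -/
theorem pfac_le {ε : ℝ} (hε : 0 < ε) {j k : ℕ} (hjk : j ≤ 2 * k) (t : ℕ) :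
    (1 + 4 * (j : ℝ) / ε) ^ (t * j) ≤ (2 * (1 + 4 * (k : ℝ) / ε)) ^ (t * j) := by
  refine pow_le_pow_left₀ (by positivity) ?_ _
  have hjk' : (j : ℝ) ≤ 2 * k := by exact_mod_cast hjk
  have : 4 * (j : ℝ) / ε ≤ 8 * k / ε := by
    rw [div_le_div_iff_of_pos_right hε]; linarith
  have h2 : 2 * (1 + 4 * (k : ℝ) / ε) = 2 + 8 * k / ε := by ring
  linarith

/-- The factor `(6j)^{tj}` for `j ≤ 2k`: `≤ (12k)^{tj}`. [folklore] -/
theorem qfac_le {j k : ℕ} (hjk : j ≤ 2 * k) (t : ℕ) :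
    (6 * (j : ℝ)) ^ (t * j) ≤ (2 * (6 * (k : ℝ))) ^ (t * j) := by
  refine pow_le_pow_left₀ (by positivity) ?_ _
  have hjk' : (j : ℝ) ≤ 2 * k := by exact_mod_cast hjk
  linarith

/-- **The closure of the Schwarz step for the constants of (6.28)** ((6.29)): under the hypothesis
`√(α_{2p+1} α_{2q+1}) ≤ γ^k α_k` on the real-point constants,
`CT √(levConst n (2p+1) · levConst n (2q+1)) ≤ levConst (n+1) k`. [cite: OsterwalderSchraderCMP1975, Ch. VI.2 (6.29)] -/
theorem closure_levConst {CT : ℝ} {α : ℕ → ℝ} (hα : ∀ k, 0 ≤ α k) {γ : ℝ} (hγ : 1 ≤ γ)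
    (hα2 : ∀ (k : ℕ) (p : Fin k), Real.sqrt (α (p + 1 + p) * α (k - 1 - p + 1 + (k - 1 - p))) ≤ γ ^ k * α k)
    (t : ℕ) {ε : ℝ} (hε : 0 < ε) (n : ℕ) {k : ℕ} (p : Fin k) :
    CT * Real.sqrt (levConst CT α γ t ε n (p + 1 + p) * levConst CT α γ t ε n (k - 1 - p + 1 + (k - 1 - p))) ≤
      levConst CT α γ t ε (n + 1) k := by
  have hk : 0 < k := Fin.pos p
  set r : ℕ := p + 1 + p with hr
  set s : ℕ := k - 1 - p + 1 + (k - 1 - p) with hs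
  have hrs : r + s = 2 * k := by rw [hr, hs]; have := p.2; omega
  have hr0 : 0 < r := by rw [hr]; omega
  have hs0 : 0 < s := by rw [hs]; omega
  have hrk : r ≤ 2 * k := by omega
  have hsk : s ≤ 2 * k := by omega
  set M₁ : ℝ := max 1 CT with hM₁
  have hM1 : 1 ≤ M₁ := le_max_left _ _
  have hCTM : CT ≤ M₁ := le_max_right _ _
  set g : ℝ := gConst CT γ t with hg
  have hg1 : 1 ≤ g := one_le_gConst CT hγ t
  set P : ℕ → ℝ := fun j => (1 + 4 * (j : ℝ) / ε) ^ (t * j) with hP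
  set Q : ℕ → ℝ := fun j => (6 * (j : ℝ)) ^ (t * j) with hQ
  have hL : ∀ n' j, levConst CT α γ t ε n' j = lev0A CT α j * P j * Q j * g ^ (j * n') := fun n' j => rfl
  have hP0 : ∀ j, 0 ≤ P j := fun j => by simp only [hP]; positivity
  have hQ0 : ∀ j, 0 ≤ Q j := fun j => by simp only [hQ]; positivity
  have hA0 : ∀ j, 0 ≤ lev0A CT α j := fun j => lev0A_nonneg hα j
  -- the comparison quantity
  set U : ℝ := M₁ * k * γ ^ k * (γ ^ k * α k) * ((2 : ℝ) ^ (t * k) * P k) * ((2 : ℝ) ^ (t * k) * Q k) * g ^ (k * n)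
    with hU
  have hU0 : 0 ≤ U := by
    rw [hU]; have := hα k; have := hP0 k; have := hQ0 k
    have : 0 ≤ γ := zero_le_one.trans hγ
    positivity
  -- (1) the product of the two constants is at most `U²`
  have hprod : levConst CT α γ t ε n r * levConst CT α γ t ε n s ≤ U ^ 2 := by
    rw [hL n r, hL n s]
    have hAr := lev0A_le (CT := CT) hα hγ hα2 hr0
    have hAs := lev0A_le (CT := CT) hα hγ hα2 hs0
    have hPr : P r ≤ (2 : ℝ) ^ (t * r) * (1 + 4 * (k : ℝ) / ε) ^ (t * r) := by
      simp only [hP]; rw [← mul_pow]; exact pfac_le hε hrk t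
    have hPs : P s ≤ (2 : ℝ) ^ (t * s) * (1 + 4 * (k : ℝ) / ε) ^ (t * s) := by
      simp only [hP]; rw [← mul_pow]; exact pfac_le hε hsk t
    have hQr : Q r ≤ (2 : ℝ) ^ (t * r) * (6 * (k : ℝ)) ^ (t * r) := by
      simp only [hQ]; rw [← mul_pow]; exact qfac_le hrk t
    have hQs : Q s ≤ (2 : ℝ) ^ (t * s) * (6 * (k : ℝ)) ^ (t * s) := by
      simp only [hQ]; rw [← mul_pow]; exact qfac_le hsk t
    -- products of the factors over `r` and `s` are squares of the factors at `k`
    have hpow2 : ∀ (b : ℝ), b ^ (t * r) * b ^ (t * s) = (b ^ (t * k)) ^ 2 := fun b => by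
      rw [← pow_add, ← mul_add, hrs, show t * (2 * k) = t * k * 2 by ring, pow_mul]
    have hgpow : g ^ (r * n) * g ^ (s * n) = (g ^ (k * n)) ^ 2 := by
      rw [← pow_add, ← add_mul, hrs, show 2 * k * n = k * n * 2 by ring, pow_mul]
    have hγpow : γ ^ r * γ ^ s = (γ ^ k) ^ 2 := by
      rw [← pow_add, hrs, show 2 * k = k * 2 by ring, pow_mul]
    -- the real-point constants
    have hαrs : α r * α s ≤ (γ ^ k * α k) ^ 2 := by
      have h := hα2 k p
      have h0 : 0 ≤ α r * α s := mul_nonneg (hα r) (hα s)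
      calc α r * α s = Real.sqrt (α r * α s) ^ 2 := (Real.sq_sqrt h0).symm
        _ ≤ (γ ^ k * α k) ^ 2 := pow_le_pow_left₀ (Real.sqrt_nonneg _) h 2
    have hrs2 : (r : ℝ) * s ≤ (k : ℝ) ^ 2 := by
      have : ((r : ℝ) + s) = 2 * k := by exact_mod_cast hrs
      nlinarith [sq_nonneg ((r : ℝ) - s)]
    -- assemble: bound each constant and multiply
    have hγ0 : 0 ≤ γ := zero_le_one.trans hγ
    have hLr : lev0A CT α r * P r * Q r * g ^ (r * n) ≤
        (M₁ * r * γ ^ r * α r) * ((2 : ℝ) ^ (t * r) * (1 + 4 * (k : ℝ) / ε) ^ (t * r)) *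
          ((2 : ℝ) ^ (t * r) * (6 * (k : ℝ)) ^ (t * r)) * g ^ (r * n) := by
      have := hα r; have := hP0 r; have := hQ0 r
      gcongr
    have hLs : lev0A CT α s * P s * Q s * g ^ (s * n) ≤
        (M₁ * s * γ ^ s * α s) * ((2 : ℝ) ^ (t * s) * (1 + 4 * (k : ℝ) / ε) ^ (t * s)) *
          ((2 : ℝ) ^ (t * s) * (6 * (k : ℝ)) ^ (t * s)) * g ^ (s * n) := by
      have := hα s; have := hP0 s; have := hQ0 s
      gcongr
    have hL0r : 0 ≤ lev0A CT α r * P r * Q r * g ^ (r * n) := by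
      have := hA0 r; have := hP0 r; have := hQ0 r; positivity
    calc (lev0A CT α r * P r * Q r * g ^ (r * n)) * (lev0A CT α s * P s * Q s * g ^ (s * n))
        ≤ ((M₁ * r * γ ^ r * α r) * ((2 : ℝ) ^ (t * r) * (1 + 4 * (k : ℝ) / ε) ^ (t * r)) *
            ((2 : ℝ) ^ (t * r) * (6 * (k : ℝ)) ^ (t * r)) * g ^ (r * n)) *
          ((M₁ * s * γ ^ s * α s) * ((2 : ℝ) ^ (t * s) * (1 + 4 * (k : ℝ) / ε) ^ (t * s)) *
            ((2 : ℝ) ^ (t * s) * (6 * (k : ℝ)) ^ (t * s)) * g ^ (s * n)) :=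
          mul_le_mul hLr hLs (by have := hA0 s; have := hP0 s; have := hQ0 s; positivity)
            (by have := hα r; positivity)
      _ = M₁ ^ 2 * ((r : ℝ) * s) * (γ ^ r * γ ^ s) * (α r * α s) *
            (((2 : ℝ) ^ (t * r) * (2 : ℝ) ^ (t * s)) * ((1 + 4 * (k : ℝ) / ε) ^ (t * r) * (1 + 4 * (k : ℝ) / ε) ^ (t * s))) *
            (((2 : ℝ) ^ (t * r) * (2 : ℝ) ^ (t * s)) * ((6 * (k : ℝ)) ^ (t * r) * (6 * (k : ℝ)) ^ (t * s))) *
            (g ^ (r * n) * g ^ (s * n)) := by ring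
      _ ≤ M₁ ^ 2 * (k : ℝ) ^ 2 * (γ ^ k) ^ 2 * (γ ^ k * α k) ^ 2 *
            (((2 : ℝ) ^ (t * k)) ^ 2 * ((1 + 4 * (k : ℝ) / ε) ^ (t * k)) ^ 2) *
            (((2 : ℝ) ^ (t * k)) ^ 2 * ((6 * (k : ℝ)) ^ (t * k)) ^ 2) * (g ^ (k * n)) ^ 2 := by
          rw [hpow2 2, hpow2 (1 + 4 * (k : ℝ) / ε), hpow2 (6 * (k : ℝ)), hgpow, hγpow]
          have h1 : 0 ≤ M₁ ^ 2 := sq_nonneg _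
          have h2 : 0 ≤ α r * α s := mul_nonneg (hα r) (hα s)
          gcongr
      _ = U ^ 2 := by rw [hU]; simp only [hP, hQ]; ring
  -- (2) hence the square root is at most `U`
  have hsqrt : Real.sqrt (levConst CT α γ t ε n r * levConst CT α γ t ε n s) ≤ U := by
    calc Real.sqrt (levConst CT α γ t ε n r * levConst CT α γ t ε n s) ≤ Real.sqrt (U ^ 2) := Real.sqrt_le_sqrt hprod
      _ = U := Real.sqrt_sq hU0
  -- (3) `CT · U ≤ levConst (n+1) k`
  have hgk : M₁ ^ 2 * k * (γ ^ k) ^ 2 * (4 : ℝ) ^ (t * k) ≤ g ^ k := by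
    have hk2 : (k : ℝ) ≤ 2 ^ k := by exact_mod_cast (Nat.lt_two_pow_self).le
    have hM1k : M₁ ^ 2 ≤ (M₁ ^ 2) ^ k := by
      conv_lhs => rw [← pow_one (M₁ ^ 2)]
      exact pow_le_pow_right₀ (one_le_pow₀ hM1) hk
    have hgk' : g ^ k = (4 : ℝ) ^ (t * k) * (2 : ℝ) ^ k * (M₁ ^ 2) ^ k * (γ ^ k) ^ 2 := by
      rw [hg, gConst, ← hM₁]
      rw [mul_pow, mul_pow, mul_pow, ← pow_mul, ← pow_mul, ← pow_mul, show 2 * k = k * 2 by ring, pow_mul]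
      ring
    rw [hgk']
    have h4 : 0 ≤ (4 : ℝ) ^ (t * k) := by positivity
    have hγk : 0 ≤ (γ ^ k) ^ 2 := sq_nonneg _
    calc M₁ ^ 2 * k * (γ ^ k) ^ 2 * (4 : ℝ) ^ (t * k) = (4 : ℝ) ^ (t * k) * k * M₁ ^ 2 * (γ ^ k) ^ 2 := by ring
      _ ≤ (4 : ℝ) ^ (t * k) * (2 : ℝ) ^ k * (M₁ ^ 2) ^ k * (γ ^ k) ^ 2 := by gcongr
  calc CT * Real.sqrt (levConst CT α γ t ε n r * levConst CT α γ t ε n s) ≤ M₁ * U :=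
        mul_le_mul hCTM hsqrt (Real.sqrt_nonneg _) (zero_le_one.trans hM1)
    _ = (M₁ ^ 2 * k * (γ ^ k) ^ 2 * (4 : ℝ) ^ (t * k)) * (α k * P k * Q k * g ^ (k * n)) := by
        rw [hU, show (4 : ℝ) ^ (t * k) = (2 : ℝ) ^ (t * k) * (2 : ℝ) ^ (t * k) by rw [← mul_pow]; norm_num]
        ring
    _ ≤ g ^ k * (lev0A CT α k * P k * Q k * g ^ (k * n)) := by
        refine mul_le_mul hgk ?_ (by have := hα k; have := hP0 k; have := hQ0 k; positivity)
          (pow_nonneg (zero_le_one.trans hg1) _)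
        have := hP0 k; have := hQ0 k
        gcongr
        exact le_lev0A_self CT α k
    _ = levConst CT α γ t ε (n + 1) k := by
        rw [hL (n + 1) k, show k * (n + 1) = k * n + k by ring, pow_add]; ring

/-! ### (6.28) at every level -/

section Levels

variable [CompleteSpace H] {T : ℂ → H →L[ℂ] H} {CT : ℝ}
  {Φ : (n : ℕ) → (Fin (n + 1) → E) → ℝ → (Fin n → ℝ) → H}
  {good : (k : ℕ) → (Fin (k + 1) → E) → Prop} {S₀ : (k : ℕ) → (Fin (k + 1) → E) → (Fin k → ℂ) → ℂ}
  {C₀ : ℕ → ℝ} {p₀ : ℕ → ℕ} {α : ℕ → ℝ} {t : ℕ} {γ ε : ℝ}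

omit [CompleteSpace H] in
/-- The bound of the semigroup is nonnegative. [folklore] -/
theorem IsOSSemigroup.CT_nonneg (hT : IsOSSemigroup T CT) : 0 ≤ CT :=
  (norm_nonneg _).trans (hT.norm_le 1 (by simp))

/-- **The bound (6.28) at every level** (OS II Ch. VI.2, induction on `N`): for a family `Sfam`
holomorphic on `ℂ₊ᵏ` for the good labels, equal to `S₀` at the positive real points and satisfying
the level-free Schwarz inequality with constant `CT` (the tower of `OSLabelledTower` started at
`exists_levelZero`), the regularised functions obey `‖S_{k,ε}‖ ≤ levConst n k` on the region of
`c_k^{(n+1)}`, for every `n`, `k`, good label, `0 < ε ≤ 1`. [cite: OsterwalderSchraderCMP1975, Ch. VI.2 (6.28)–(6.29)] -/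
theorem IsOSLabelledRealData.norm_regFun_le_level (hT : IsOSSemigroup T CT) (hΦ : IsOSLabelledVectors T Φ)
    (hgood : IsOSLabelSet good) (hD : IsOSLabelledRealData good S₀ Φ C₀ p₀) (hα : ∀ k, 0 ≤ α k)
    (hsum : ∀ (k : ℕ) (c : Fin (k + 1) → E), good k c → ∀ ρ : Fin k → ℝ, (∀ i, 0 < ρ i) →
      ‖S₀ k c (fun i => (ρ i : ℂ))‖ ≤ α k * ((1 + ∑ i, ρ i) * (1 + ∑ i, (ρ i)⁻¹)) ^ (t * k))
    (hγ : 1 ≤ γ)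
    (hα2 : ∀ (k : ℕ) (p : Fin k), Real.sqrt (α (p + 1 + p) * α (k - 1 - p + 1 + (k - 1 - p))) ≤ γ ^ k * α k)
    (hε0 : 0 < ε) (hε1 : ε ≤ 1)
    {Sfam : (k : ℕ) → (Fin (k + 1) → E) → (Fin k → ℂ) → ℂ}
    (hhol : ∀ (k : ℕ) (c : Fin (k + 1) → E), good k c → 0 < k → DifferentiableOn ℂ (Sfam k c) {Z | ∀ i, 0 < (Z i).re})
    (hreal : ∀ (k : ℕ) (c : Fin (k + 1) → E), good k c → ∀ ρ : Fin k → ℝ, (∀ i, 0 < ρ i) →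
      Sfam k c (fun i => (ρ i : ℂ)) = S₀ k c (fun i => (ρ i : ℂ)))
    (hSchw : ∀ (k : ℕ) (c : Fin (k + 1) → E), good k c → ∀ (p : Fin k) (Z : Fin k → ℂ), (∀ i, 0 < (Z i).re) →
      ∀ (x' x : ℝ) (τ : ℂ), 0 < x' → 0 < x → 0 < τ.re → (x' : ℂ) + x + τ = Z p →
        ‖Sfam k c Z‖ ≤ CT *
          Real.sqrt ((Sfam (p + 1 + p) (dblPos (posRevLeft c p))
            (cDiagEmbed (blockRevLeft Z p) ((2 * x' : ℝ) : ℂ) (star (blockRevLeft Z p)))).re) *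
          Real.sqrt ((Sfam (k - 1 - p + 1 + (k - 1 - p)) (dblPos (posRight c p))
            (cDiagEmbed (star (blockRight Z p)) ((2 * x : ℝ) : ℂ) (blockRight Z p))).re)) :
    ∀ (n k : ℕ) (c : Fin (k + 1) → E), good k c → ∀ Z ∈ argRegion (osBaseC (n + 1) k),
      ‖regFun Sfam ε t k c Z‖ ≤ levConst CT α γ t ε n k := by
  intro n
  induction n with
  | zero =>
    intro k c hc Z hZ
    cases k with
    | zero => rw [osBaseC_succ_zero, argRegion_empty] at hZ; exact absurd hZ (notMem_empty _)
    | succ m =>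
      rw [levConst, mul_zero, pow_zero, mul_one]
      exact norm_regFun_le_levelZero hT hΦ hgood hD hα hsum hε0 hε1 le_rfl hhol hreal hc hZ
  | succ n ih =>
    intro k c hc Z hZ
    have h := tempered_step (Sext := Sfam) (T := t) hgood hε0 hT.CT_nonneg hhol hSchw
      (fun k => levConst_nonneg hα hγ t hε0 n k) ih
      (fun k p => closure_levConst (CT := CT) hα hγ hα2 t hε0 n p) k c hc hZ
    rwa [max_eq_right (levConst_le_succ hα hγ t hε0 n k)] at h

end Levels

/-! ### The undoing of the regularisation: (6.30)–(6.31) -/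

section Undo

variable [CompleteSpace H] {T : ℂ → H →L[ℂ] H} {CT : ℝ}
  {Φ : (n : ℕ) → (Fin (n + 1) → E) → ℝ → (Fin n → ℝ) → H}
  {good : (k : ℕ) → (Fin (k + 1) → E) → Prop} {S₀ : (k : ℕ) → (Fin (k + 1) → E) → (Fin k → ℂ) → ℂ}
  {C₀ : ℕ → ℝ} {p₀ : ℕ → ℕ} {α : ℕ → ℝ} {t : ℕ} {γ : ℝ}

set_option maxHeartbeats 800000 in
/-- **Osterwalder–Schrader II, Theorem 4.2 with the temperedness estimate (4.6), from real-point
data.** Under the semigroup hypotheses, the labelled real-point vectors, a class of labels closed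
under the doubling of the parts, labelled real-point data (Gram identities (5.2) at positive real
points, continuity, growth) and the **sum-form real bound with exponent linear in `k`** (E0', (6.20))
with constants `α_k` satisfying `√(α_{2p+1} α_{2q+1}) ≤ γ^k α_k`: there is a family `Sext k c`,
holomorphic on `ℂ₊ᵏ` for the good labels `c` and `k ≥ 1`, equal to `S₀ k c` at the positive real
points, and such that for every `k ≥ 1` there are `C, e` with
`‖Sext k c ζ‖ ≤ C (1 + ∑‖ζᵢ‖)^e (1 + ∑ (Re ζᵢ)⁻¹)^e` for all `ζ ∈ ℂ₊ᵏ` and all good labels `c`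
((4.6), uniformly in the labels; level choice (6.30) by `osBaseC_exists_level_arg`, shift
`ε = min 1 (1/(2∑(Re ζᵢ)⁻¹))`). [cite: OsterwalderSchraderCMP1975, §IV.2 Thm. 4.2 (4.6); Ch. VI.2 (6.28)–(6.31)] -/
theorem IsOSLabelledRealData.exists_tempered_tower (hT : IsOSSemigroup T CT) (hΦ : IsOSLabelledVectors T Φ)
    (hgood : IsOSLabelSet good) (hD : IsOSLabelledRealData good S₀ Φ C₀ p₀) (hα : ∀ k, 0 ≤ α k)
    (hsum : ∀ (k : ℕ) (c : Fin (k + 1) → E), good k c → ∀ ρ : Fin k → ℝ, (∀ i, 0 < ρ i) →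
      ‖S₀ k c (fun i => (ρ i : ℂ))‖ ≤ α k * ((1 + ∑ i, ρ i) * (1 + ∑ i, (ρ i)⁻¹)) ^ (t * k))
    (hγ : 1 ≤ γ)
    (hα2 : ∀ (k : ℕ) (p : Fin k), Real.sqrt (α (p + 1 + p) * α (k - 1 - p + 1 + (k - 1 - p))) ≤ γ ^ k * α k) :
    ∃ Sext : (k : ℕ) → (Fin (k + 1) → E) → (Fin k → ℂ) → ℂ,
      (∀ (k : ℕ) (c : Fin (k + 1) → E), good k c → 0 < k → DifferentiableOn ℂ (Sext k c) {Z | ∀ i, 0 < (Z i).re}) ∧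
      (∀ (k : ℕ) (c : Fin (k + 1) → E), good k c → ∀ ρ : Fin k → ℝ, (∀ i, 0 < ρ i) →
        Sext k c (fun i => (ρ i : ℂ)) = S₀ k c (fun i => (ρ i : ℂ))) ∧
      ∀ k : ℕ, 0 < k → ∃ (C : ℝ) (e : ℕ), ∀ c : Fin (k + 1) → E, good k c → ∀ ζ : Fin k → ℂ, (∀ i, 0 < (ζ i).re) →
        ‖Sext k c ζ‖ ≤ C * (1 + ∑ i, ‖ζ i‖) ^ e * (1 + ∑ i, ((ζ i).re)⁻¹) ^ e := by
  classical
  -- the tower started at the first level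
  obtain ⟨S, hL0, hG0, hrealS⟩ := hD.exists_levelZero hT hΦ hgood
  obtain ⟨Sx, hholx, heqx, -, hSchwx⟩ := hL0.exists_tower hT hΦ hgood hG0
  set Sfam : (k : ℕ) → (Fin (k + 1) → E) → (Fin k → ℂ) → ℂ := fun k c Z =>
    if 0 < k then Sx k c Z else S₀ k c Z with hSfam
  have hSf : ∀ k, 0 < k → ∀ c, Sfam k c = Sx k c := fun k hk c => by funext Z; simp only [hSfam, if_pos hk]
  have hhol : ∀ (k : ℕ) (c : Fin (k + 1) → E), good k c → 0 < k →
      DifferentiableOn ℂ (Sfam k c) {Z | ∀ i, 0 < (Z i).re} := fun k c hc hk => by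
    rw [hSf k hk]; exact hholx k c hc hk
  have hreal : ∀ (k : ℕ) (c : Fin (k + 1) → E), good k c → ∀ ρ : Fin k → ℝ, (∀ i, 0 < ρ i) →
      Sfam k c (fun i => (ρ i : ℂ)) = S₀ k c (fun i => (ρ i : ℂ)) := by
    intro k c hc ρ hρ
    rcases Nat.eq_zero_or_pos k with rfl | hk
    · simp only [hSfam, lt_self_iff_false, if_false]
    · rw [hSf k hk]
      have hmem : (fun i => (ρ i : ℂ)) ∈ argRegion (osBaseC (0 + 1) k) :=
        ofReal_mem_argRegion (zero_mem_osBaseC _ hk) hρ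
      rw [heqx k c hmem, hrealS k c ρ hρ]
  have hSchw : ∀ (k : ℕ) (c : Fin (k + 1) → E), good k c → ∀ (p : Fin k) (Z : Fin k → ℂ), (∀ i, 0 < (Z i).re) →
      ∀ (x' x : ℝ) (τ : ℂ), 0 < x' → 0 < x → 0 < τ.re → (x' : ℂ) + x + τ = Z p →
        ‖Sfam k c Z‖ ≤ CT *
          Real.sqrt ((Sfam (p + 1 + p) (dblPos (posRevLeft c p))
            (cDiagEmbed (blockRevLeft Z p) ((2 * x' : ℝ) : ℂ) (star (blockRevLeft Z p)))).re) *
          Real.sqrt ((Sfam (k - 1 - p + 1 + (k - 1 - p)) (dblPos (posRight c p))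
            (cDiagEmbed (star (blockRight Z p)) ((2 * x : ℝ) : ℂ) (blockRight Z p))).re) := by
    intro k c hc p Z hZ x' x τ hx' hx hτ hsplit
    rw [hSf k (Fin.pos p), hSf (p + 1 + p) (by omega), hSf (k - 1 - p + 1 + (k - 1 - p)) (by omega)]
    exact (hSchwx k c hc p Z hZ x' x τ hx' hx hτ.le hsplit).trans (mul_le_mul_of_nonneg_right
      (mul_le_mul_of_nonneg_right (hT.norm_le τ hτ) (Real.sqrt_nonneg _)) (Real.sqrt_nonneg _))
  refine ⟨Sfam, hhol, hreal, fun k hk => ?_⟩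
  -- the data-independent level constant and the dyadic bound on `g`
  obtain ⟨k', rfl⟩ : ∃ k', k = k' + 1 := ⟨k - 1, by omega⟩
  obtain ⟨A, hA1, hA⟩ := osBaseC_exists_level_arg k'
  set g : ℝ := gConst CT γ t with hg
  have hg1 : 1 ≤ g := one_le_gConst CT hγ t
  obtain ⟨dg, hdg⟩ := pow_unbounded_of_one_lt g (one_lt_two (α := ℝ))
  -- the constants
  set kk : ℕ := k' + 1 with hkk
  set Cfin : ℝ := lev0A CT α kk * (10 * kk : ℝ) ^ (t * kk) * (6 * kk : ℝ) ^ (t * kk) *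
    (4 * A) ^ (dg * kk) * (2 * (kk + 1) : ℝ) ^ (kk * t) with hCfin
  refine ⟨Cfin, 2 * dg * kk + 2 * kk * t, fun c hc ζ hζ => ?_⟩
  have hkpos : 0 < kk := Nat.succ_pos k'
  have hk1 : (1 : ℝ) ≤ kk := by exact_mod_cast hkpos
  -- the shift
  set ρ : ℝ := ∑ i, ((ζ i).re)⁻¹ with hρ
  have hρpos : 0 < ρ := by
    rw [hρ]; exact Finset.sum_pos (fun i _ => inv_pos.2 (hζ i)) ⟨0, Finset.mem_univ _⟩
  have hρi : ∀ i, ((ζ i).re)⁻¹ ≤ ρ := fun i =>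
    Finset.single_le_sum (f := fun i => ((ζ i).re)⁻¹) (fun i _ => (inv_pos.2 (hζ i)).le) (Finset.mem_univ i)
  set ε : ℝ := min 1 (1 / (2 * ρ)) with hε
  have hε0 : 0 < ε := lt_min one_pos (by positivity)
  have hε1 : ε ≤ 1 := min_le_left _ _
  have hεre : ∀ i, ε ≤ (ζ i).re / 2 := fun i => by
    have h1 : ε ≤ 1 / (2 * ρ) := min_le_right _ _
    have h2 : 1 / (2 * ρ) ≤ (ζ i).re / 2 := by
      rw [div_le_div_iff₀ (by positivity) two_pos]
      have h3 : ((ζ i).re)⁻¹ * (ζ i).re = 1 := inv_mul_cancel₀ (hζ i).ne'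
      nlinarith [hρi i, hζ i]
    linarith
  have hεinv : ε⁻¹ ≤ 1 + 2 * ρ := by
    rw [hε]
    rcases le_total 1 (1 / (2 * ρ)) with h | h
    · rw [min_eq_left h, inv_one]; linarith
    · rw [min_eq_right h, one_div, inv_inv]; linarith
  set Z : Fin kk → ℂ := fun i => ζ i - ε with hZ
  have hZre : ∀ i, 0 < (Z i).re := fun i => by
    simp only [hZ, Complex.sub_re, Complex.ofReal_re]; linarith [hεre i, hζ i]
  have hZre' : ∀ i, (ζ i).re / 2 ≤ (Z i).re := fun i => by
    simp only [hZ, Complex.sub_re, Complex.ofReal_re]; linarith [hεre i]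
  have hshift : shiftVec ε Z = ζ := by funext i; simp [hZ, shiftVec]
  -- the level
  obtain ⟨N, hN, h2N⟩ := hA Z hZre
  have hZmem : Z ∈ argRegion (osBaseC (N + 1) kk) := ⟨hZre, hN⟩
  -- (6.28) at level `N`
  have hreg := hD.norm_regFun_le_level hT hΦ hgood hα hsum hγ hα2 hε0 hε1 hhol hreal hSchw N kk c hc Z hZmem
  -- undo the weight
  have hw0 : osWeight kk ε t Z ≠ 0 := osWeight_ne_zero hkpos hε0 t hZre
  have hval : ‖Sfam kk c ζ‖ = ‖regFun Sfam ε t kk c Z‖ * ‖osW kk ε Z‖ ^ (kk * t) := by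
    rw [regFun, hshift, norm_mul, osWeight, norm_pow, norm_inv, mul_comm, ← mul_assoc, ← mul_pow,
      mul_inv_cancel₀ (norm_ne_zero_iff.2 (osW_ne_zero hkpos hε0 hZre)), one_pow, one_mul]
  -- the quantities in terms of `Sζ = ∑‖ζᵢ‖` and `ρ`
  set Sζ : ℝ := ∑ i, ‖ζ i‖ with hSζ
  have hSζ0 : 0 ≤ Sζ := Finset.sum_nonneg fun i _ => norm_nonneg _
  have hZnorm : ∀ i, ‖Z i‖ ≤ ‖ζ i‖ + 1 := fun i => by
    calc ‖Z i‖ = ‖ζ i - ε‖ := rfl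
      _ ≤ ‖ζ i‖ + ‖(ε : ℂ)‖ := norm_sub_le _ _
      _ ≤ ‖ζ i‖ + 1 := by rw [Complex.norm_real, Real.norm_eq_abs, abs_of_pos hε0]; linarith
  have hsumZ : ∑ i, ‖Z i‖ ≤ Sζ + kk := by
    calc ∑ i, ‖Z i‖ ≤ ∑ i, (‖ζ i‖ + 1) := Finset.sum_le_sum fun i _ => hZnorm i
      _ = Sζ + kk := by rw [Finset.sum_add_distrib, Finset.sum_const, Finset.card_univ, Fintype.card_fin]; simp [hSζ]
  -- (a) the weight base
  have hosW : ‖osW kk ε Z‖ ≤ 2 * (kk + 1) * ((1 + Sζ) * (1 + ρ)) := by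
    have h1 : ‖osW kk ε Z‖ ≤ ε⁻¹ + (∑ i, ‖Z i‖) / kk := by
      unfold osW
      refine (norm_add_le _ _).trans (add_le_add (by rw [Complex.norm_real, Real.norm_eq_abs, abs_of_pos (inv_pos.2 hε0)]) ?_)
      rw [norm_div, show ((kk : ℂ)) = ((kk : ℝ) : ℂ) by simp, Complex.norm_real, Real.norm_eq_abs,
        abs_of_pos (by positivity)]
      exact div_le_div_of_nonneg_right (norm_sum_le _ _) (by positivity)
    have h2 : (∑ i, ‖Z i‖) / kk ≤ Sζ + kk := by
      rw [div_le_iff₀ (by positivity)]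
      have : 0 ≤ ∑ i, ‖Z i‖ := Finset.sum_nonneg fun i _ => norm_nonneg _
      nlinarith [hsumZ]
    have h3 : ε⁻¹ + (Sζ + kk) ≤ 2 * (kk + 1) * ((1 + Sζ) * (1 + ρ)) := by
      have p1 : 0 ≤ (kk : ℝ) * Sζ := mul_nonneg (Nat.cast_nonneg _) hSζ0
      have p2 : 0 ≤ (kk : ℝ) * ρ := mul_nonneg (Nat.cast_nonneg _) hρpos.le
      have p3 : 0 ≤ Sζ * ρ := mul_nonneg hSζ0 hρpos.le
      have p4 : 0 ≤ (kk : ℝ) * Sζ * ρ := mul_nonneg p1 hρpos.le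
      have hexp : 2 * ((kk : ℝ) + 1) * ((1 + Sζ) * (1 + ρ)) =
          2 * kk + 2 + 2 * (kk * Sζ) + 2 * Sζ + 2 * (kk * ρ) + 2 * ρ + 2 * (kk * Sζ * ρ) + 2 * (Sζ * ρ) := by ring
      rw [hexp]
      linarith [hεinv, hρpos.le, hSζ0, hk1]
    linarith
  -- (b) the level factor
  have hTsum : ∑ i, ‖Z i‖ / (Z i).re ≤ 2 * (1 + Sζ) * (1 + ρ) := by
    calc ∑ i, ‖Z i‖ / (Z i).re ≤ ∑ i, (1 + Sζ) * (2 * ((ζ i).re)⁻¹) := Finset.sum_le_sum fun i _ => by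
          rw [div_le_iff₀ (hZre i)]
          have hn : ‖Z i‖ ≤ 1 + Sζ := (hZnorm i).trans (by
            have := Finset.single_le_sum (f := fun i => ‖ζ i‖) (fun i _ => norm_nonneg _) (Finset.mem_univ i)
            linarith)
          have h4 : (1 + Sζ) * (2 * ((ζ i).re)⁻¹) * (Z i).re ≥ (1 + Sζ) * (2 * ((ζ i).re)⁻¹) * ((ζ i).re / 2) :=
            mul_le_mul_of_nonneg_left (hZre' i) (mul_nonneg (by linarith) (mul_nonneg zero_le_two (inv_pos.2 (hζ i)).le))
          have h5 : (1 + Sζ) * (2 * ((ζ i).re)⁻¹) * ((ζ i).re / 2) = 1 + Sζ := by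
            rw [show (1 + Sζ) * (2 * ((ζ i).re)⁻¹) * ((ζ i).re / 2) = (1 + Sζ) * (((ζ i).re)⁻¹ * (ζ i).re) by ring,
              inv_mul_cancel₀ (hζ i).ne', mul_one]
          linarith
      _ = 2 * (1 + Sζ) * ρ := by rw [← Finset.mul_sum, ← Finset.mul_sum, hρ]; ring
      _ ≤ 2 * (1 + Sζ) * (1 + ρ) := by nlinarith
  have hlev : g ^ (kk * N) ≤ (4 * A * ((1 + Sζ) * (1 + ρ)) ^ 2) ^ (dg * kk) := by
    have h1 : g ^ (kk * N) ≤ ((2 : ℝ) ^ dg) ^ (kk * N) := pow_le_pow_left₀ (zero_le_one.trans hg1) hdg.le _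
    have h2 : ((2 : ℝ) ^ dg) ^ (kk * N) = ((2 : ℝ) ^ N) ^ (dg * kk) := by
      rw [← pow_mul, ← pow_mul]; ring_nf
    have h3 : (2 : ℝ) ^ N ≤ 4 * A * ((1 + Sζ) * (1 + ρ)) ^ 2 := by
      refine h2N.trans ?_
      calc A * (∑ i, ‖Z i‖ / (Z i).re) ^ 2 ≤ A * (2 * (1 + Sζ) * (1 + ρ)) ^ 2 := by
            refine mul_le_mul_of_nonneg_left (pow_le_pow_left₀ ?_ hTsum 2) (zero_le_one.trans hA1)
            exact Finset.sum_nonneg fun i _ => div_nonneg (norm_nonneg _) (hZre i).le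
        _ = 4 * A * ((1 + Sζ) * (1 + ρ)) ^ 2 := by ring
    rw [h2] at h1
    exact h1.trans (pow_le_pow_left₀ (by positivity) h3 _)
  -- (c) the first-level constant at this `ε`
  have hlev0 : lev0Const CT α t kk ε ≤ lev0A CT α kk * (10 * kk : ℝ) ^ (t * kk) * (6 * kk : ℝ) ^ (t * kk) * (1 + ρ) ^ (t * kk) := by
    unfold lev0Const
    have h1 : 1 + 4 * (kk : ℝ) / ε ≤ 10 * kk * (1 + ρ) := by
      rw [div_eq_mul_inv]
      have e1 : 4 * (kk : ℝ) * ε⁻¹ ≤ 4 * kk * (1 + 2 * ρ) := mul_le_mul_of_nonneg_left hεinv (by positivity)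
      have e2 : 0 ≤ (kk : ℝ) * ρ := mul_nonneg (Nat.cast_nonneg _) hρpos.le
      have hexp1 : 4 * (kk : ℝ) * (1 + 2 * ρ) = 4 * kk + 8 * (kk * ρ) := by ring
      have hexp2 : 10 * (kk : ℝ) * (1 + ρ) = 10 * kk + 10 * (kk * ρ) := by ring
      rw [hexp2]; rw [hexp1] at e1
      linarith [hk1]
    calc lev0A CT α kk * (1 + 4 * (kk : ℝ) / ε) ^ (t * kk) * (6 * kk : ℝ) ^ (t * kk)
        ≤ lev0A CT α kk * (10 * kk * (1 + ρ)) ^ (t * kk) * (6 * kk : ℝ) ^ (t * kk) := by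
          have := lev0A_nonneg (CT := CT) hα kk
          gcongr
      _ = lev0A CT α kk * (10 * kk : ℝ) ^ (t * kk) * (6 * kk : ℝ) ^ (t * kk) * (1 + ρ) ^ (t * kk) := by
          rw [mul_pow]; ring
  -- assemble
  set X : ℝ := (1 + Sζ) * (1 + ρ) with hX
  have hX1 : 1 ≤ X := by rw [hX]; nlinarith
  have hX0 : 0 ≤ X := zero_le_one.trans hX1
  have hA0 : 0 ≤ lev0A CT α kk := lev0A_nonneg hα kk
  have hApos : 0 ≤ A := zero_le_one.trans hA1
  set C1 : ℝ := lev0A CT α kk * (10 * kk : ℝ) ^ (t * kk) * (6 * kk : ℝ) ^ (t * kk) with hC1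
  have hC10 : 0 ≤ C1 := by rw [hC1]; positivity
  -- the regularised function
  have hR1 : ‖regFun Sfam ε t kk c Z‖ ≤ C1 * (1 + ρ) ^ (t * kk) * ((4 * A) ^ (dg * kk) * X ^ (2 * (dg * kk))) := by
    have h := hreg
    rw [levConst] at h
    refine h.trans ?_
    have e1 : (4 * A * X ^ 2) ^ (dg * kk) = (4 * A) ^ (dg * kk) * X ^ (2 * (dg * kk)) := by
      rw [mul_pow, ← pow_mul]
    rw [← e1]
    exact mul_le_mul hlev0 hlev (pow_nonneg (zero_le_one.trans hg1) _) (by positivity)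
  -- the weight
  have hR2 : ‖osW kk ε Z‖ ^ (kk * t) ≤ (2 * (kk + 1) : ℝ) ^ (kk * t) * X ^ (kk * t) := by
    rw [← mul_pow]; exact pow_le_pow_left₀ (norm_nonneg _) hosW _
  -- the product
  have hXpow : ∀ a : ℕ, X ^ a = (1 + Sζ) ^ a * (1 + ρ) ^ a := fun a => by rw [hX, mul_pow]
  have he1 : 2 * (dg * kk) + kk * t ≤ 2 * dg * kk + 2 * kk * t := by nlinarith
  have he2 : t * kk + (2 * (dg * kk) + kk * t) ≤ 2 * dg * kk + 2 * kk * t := by nlinarith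
  rw [hval]
  calc ‖regFun Sfam ε t kk c Z‖ * ‖osW kk ε Z‖ ^ (kk * t)
      ≤ (C1 * (1 + ρ) ^ (t * kk) * ((4 * A) ^ (dg * kk) * X ^ (2 * (dg * kk)))) *
          ((2 * (kk + 1) : ℝ) ^ (kk * t) * X ^ (kk * t)) :=
        mul_le_mul hR1 hR2 (by positivity) (by positivity)
    _ = Cfin * ((1 + ρ) ^ (t * kk) * X ^ (2 * (dg * kk) + kk * t)) := by
        rw [hCfin, hC1, pow_add]; ring
    _ = Cfin * ((1 + Sζ) ^ (2 * (dg * kk) + kk * t) * (1 + ρ) ^ (t * kk + (2 * (dg * kk) + kk * t))) := by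
        rw [hXpow, pow_add (1 + ρ) (t * kk)]; ring
    _ ≤ Cfin * ((1 + Sζ) ^ (2 * dg * kk + 2 * kk * t) * (1 + ρ) ^ (2 * dg * kk + 2 * kk * t)) := by
        refine mul_le_mul_of_nonneg_left (mul_le_mul (pow_le_pow_right₀ (by linarith) he1) (pow_le_pow_right₀ (by linarith) he2)
          (by positivity) (by positivity)) ?_
        rw [hCfin]; positivity
    _ = Cfin * (1 + Sζ) ^ (2 * dg * kk + 2 * kk * t) * (1 + ρ) ^ (2 * dg * kk + 2 * kk * t) := by ring

end Undo

end Literature.MathematicalPhysics.QuantumFieldTheory.OSEnvelope
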